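import Literature.NumberTheory.Automorphic.QuaternionUnitsPlacesSplittingCentralizer
import Literature.MeasureTheory.Group.InvariantQuotientOrbitalPiProdNormalized
import HarnessLib

/-!
# Gelbart's (10.19) on the `Dˣ` side over `S` with its equality sign (quotients of product Haar measures)
(Gelbart, *Automorphic forms on adele groups* (1975), §10, p. 155, (10.19))

Topic `NumberTheory/Automorphic`; theorems only (no definition, no named fact, no instance visible
to importers). The `Dˣ` twin of `GLnPlacesSplittingOrbitalNormalized`:
`QuaternionUnitsPlacesSplittingCentralizer` factors the orbital integrals of `Φ' = (⊗_{v ∈ S} ξ'_v) ⊗ Θ'`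
along `Quat.placesSplitting K D S : D_Sˣ × D^{S,×} ≃ₜ* D_𝔸ˣ` for arbitrary invariant measures up to ONE
constant `c ≠ 0`. For the canonical quotient measures `ν/ρ = quotientMeasure` of Haar measures that are
products along the splitting — `ν = s_*((⨂_v ν_v) ⊗ ν^S)` on `D_𝔸ˣ` and `ρ = s_*((⨂_v ρ_v) ⊗ ρ^S)` on the
torus `B'_𝔸 = C(γ) = s((Π_v B'_v) × B'^S)` (the measures on the intermediate subgroups and the
correspondences are hypotheses, as in the abstract `InvariantQuotientOrbitalPiProdNormalized`) — the
constant is `1`, which is (10.19)' as used on p. 154: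

* `Quat.lintegral_descConj_quotientMeasure_eq_prod_mul` (`[0, ∞]`-valued, measurable data: the shape
  of the orbital integrals `∫⁻ descConj (toAdelic γ') C(γ') F' d(quotientMeasure C(γ') ν'_C ν')` in the
  class-term comparison `quaternion_glTwo_classTerm_eq`);
* `Quat.integral_descConj_quotientMeasure_eq_prod_mul` (complex-valued).

Statements are on `adelicUnits K D`, `completionUnits D v`; the topological / measurable instances on
these types are hypotheses (supplied in applications by `t2Space_adelicUnits`,
`locallyCompactSpace_adelicUnits`, `secondCountableTopology_adelicUnits` and Borel structures).

Part of the inline (D-0026) decomposition of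
`Literature.NumberTheory.Automorphic.strong_multiplicity_one_quaternionUnits`.

## References

* S. Gelbart, *Automorphic forms on adele groups*, Ann. of Math. Studies 83 (1975), §10, p. 155,
  (10.19); p. 154 (10.14) [Gelbart1975].
-/

noncomputable section

open MeasureTheory MeasureTheory.Measure NumberField IsDedekindDomain
open scoped NNReal ENNReal

universe u

namespace Literature.NumberTheory.Automorphic

open Literature.MeasureTheory.Group

section OrbitalNormalized

variable {K : Type} [Field K] [NumberField K] {D : Type u} [Ring D] [Algebra K D] [Module.Finite K D]
  {S : Finset (HeightOneSpectrum (𝓞 K))}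

variable (K D S) in
/-- `D^{S,×}` is locally compact when `D_𝔸ˣ` is (a closed subgroup). [folklore] -/
theorem Quat.locallyCompactSpace_trivialAt [LocallyCompactSpace (adelicUnits K D)] :
    LocallyCompactSpace (Quat.trivialAt K D S) :=
  (Quat.isClosed_trivialAt K D S).isClosedEmbedding_subtypeVal.locallyCompactSpace

attribute [local instance] Quat.locallyCompactSpace_trivialAt

variable [MeasurableSpace (adelicUnits K D)] [BorelSpace (adelicUnits K D)] [T2Space (adelicUnits K D)]
    [LocallyCompactSpace (adelicUnits K D)] [SecondCountableTopology (adelicUnits K D)]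
    [∀ v : HeightOneSpectrum (𝓞 K), MeasurableSpace (completionUnits D v)]
    [∀ v : HeightOneSpectrum (𝓞 K), BorelSpace (completionUnits D v)]
    [∀ v : HeightOneSpectrum (𝓞 K), SecondCountableTopology (completionUnits D v)]
    [∀ v : HeightOneSpectrum (𝓞 K), LocallyCompactSpace (completionUnits D v)]
    (γ : (adelicUnits K D))
    (hC : IsClosed ((Subgroup.centralizer ({γ} : Set (adelicUnits K D)) :
      Subgroup (adelicUnits K D)) : Set (adelicUnits K D)))
    (hCv : ∀ v : S, IsClosed ((Subgroup.centralizer ({toCompletionUnits K D (v : HeightOneSpectrum (𝓞 K)) γ} :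
      Set (completionUnits D (v : HeightOneSpectrum (𝓞 K)))) :
        Set (completionUnits D (v : HeightOneSpectrum (𝓞 K))))))
    (hC' : IsClosed ((Subgroup.centralizer ({((Quat.placesSplitting K D S).symm γ).2} :
      Set (Quat.trivialAt K D S))) : Set (Quat.trivialAt K D S)))
    [MeasurableSpace ((adelicUnits K D) ⧸
      Subgroup.centralizer ({γ} : Set (adelicUnits K D)))]
    [BorelSpace ((adelicUnits K D) ⧸
      Subgroup.centralizer ({γ} : Set (adelicUnits K D)))]
    [∀ v : S, MeasurableSpace (completionUnits D (v : HeightOneSpectrum (𝓞 K)) ⧸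
      Subgroup.centralizer ({toCompletionUnits K D (v : HeightOneSpectrum (𝓞 K)) γ} :
        Set (completionUnits D (v : HeightOneSpectrum (𝓞 K)))))]
    [∀ v : S, BorelSpace (completionUnits D (v : HeightOneSpectrum (𝓞 K)) ⧸
      Subgroup.centralizer ({toCompletionUnits K D (v : HeightOneSpectrum (𝓞 K)) γ} :
        Set (completionUnits D (v : HeightOneSpectrum (𝓞 K)))))]
    [MeasurableSpace (Quat.trivialAt K D S ⧸
      Subgroup.centralizer ({((Quat.placesSplitting K D S).symm γ).2} : Set (Quat.trivialAt K D S)))]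
    [BorelSpace (Quat.trivialAt K D S ⧸
      Subgroup.centralizer ({((Quat.placesSplitting K D S).symm γ).2} : Set (Quat.trivialAt K D S)))]
    -- Haar measures on the local tori `B_v` (`v ∈ S`) and on `B^S`
    (ρv : ∀ v : S, Measure (Subgroup.centralizer ({toCompletionUnits K D (v : HeightOneSpectrum (𝓞 K)) γ} :
        Set (completionUnits D (v : HeightOneSpectrum (𝓞 K))))))
    [∀ v, (ρv v).IsMulLeftInvariant] [∀ v, IsFiniteMeasureOnCompacts (ρv v)] [∀ v, (ρv v).IsOpenPosMeasure]
    [∀ v, (ρv v).IsInvInvariant] [∀ v, SigmaFinite (ρv v)]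
    (ρ' : Measure (Subgroup.centralizer ({((Quat.placesSplitting K D S).symm γ).2} : Set (Quat.trivialAt K D S))))
    [ρ'.IsMulLeftInvariant] [IsFiniteMeasureOnCompacts ρ'] [ρ'.IsOpenPosMeasure] [ρ'.IsInvInvariant] [SFinite ρ']
    -- the product Haar measures on `Π_v B_v ≤ G_S`, on `B_S = C(γ_S) ≤ G_S`, on `B_S × B^S`, and on `B_𝔸`
    (ρp : Measure (Subgroup.pi Set.univ fun v : S =>
      Subgroup.centralizer ({toCompletionUnits K D (v : HeightOneSpectrum (𝓞 K)) γ} :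
        Set (completionUnits D (v : HeightOneSpectrum (𝓞 K))))))
    [ρp.IsMulLeftInvariant] [IsFiniteMeasureOnCompacts ρp] [ρp.IsOpenPosMeasure] [ρp.IsInvInvariant] [SFinite ρp]
    (hρp : Measure.map (subgroupPiCoords fun v : S =>
      Subgroup.centralizer ({toCompletionUnits K D (v : HeightOneSpectrum (𝓞 K)) γ} :
        Set (completionUnits D (v : HeightOneSpectrum (𝓞 K))))) ρp = Measure.pi ρv)
    (ρ₁ : Measure (Subgroup.centralizer ({fun v : S => toCompletionUnits K D (v : HeightOneSpectrum (𝓞 K)) γ} :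
      Set (Quat.LocalPi K D S))))
    [ρ₁.IsMulLeftInvariant] [IsFiniteMeasureOnCompacts ρ₁] [ρ₁.IsOpenPosMeasure] [ρ₁.IsInvInvariant] [SFinite ρ₁]
    (hρ₁ : ρ₁ = Measure.map (subgroupCongrHomeomorph (MulEquiv.refl (Quat.LocalPi K D S))
      (Subgroup.pi Set.univ fun v : S =>
        Subgroup.centralizer ({toCompletionUnits K D (v : HeightOneSpectrum (𝓞 K)) γ} :
          Set (completionUnits D (v : HeightOneSpectrum (𝓞 K)))))
      (Subgroup.centralizer ({fun v : S => toCompletionUnits K D (v : HeightOneSpectrum (𝓞 K)) γ} : Set (Quat.LocalPi K D S)))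
      (fun p => by rw [MulEquiv.refl_apply, centralizer_singleton_pi_eq]) continuous_id continuous_id) ρp)
    (ρq : Measure ((Subgroup.centralizer ({fun v : S => toCompletionUnits K D (v : HeightOneSpectrum (𝓞 K)) γ} :
        Set (Quat.LocalPi K D S))).prod
      (Subgroup.centralizer ({((Quat.placesSplitting K D S).symm γ).2} : Set (Quat.trivialAt K D S)))))
    [ρq.IsMulLeftInvariant] [IsFiniteMeasureOnCompacts ρq] [ρq.IsOpenPosMeasure] [ρq.IsInvInvariant] [SFinite ρq]
    (hρq : Measure.map (Subgroup.prodEquiv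
      (Subgroup.centralizer ({fun v : S => toCompletionUnits K D (v : HeightOneSpectrum (𝓞 K)) γ} : Set (Quat.LocalPi K D S)))
      (Subgroup.centralizer ({((Quat.placesSplitting K D S).symm γ).2} : Set (Quat.trivialAt K D S)))) ρq = ρ₁.prod ρ')
    (ρ : Measure (Subgroup.centralizer ({γ} : Set (adelicUnits K D))))
    [ρ.IsMulLeftInvariant] [IsFiniteMeasureOnCompacts ρ] [ρ.IsOpenPosMeasure] [ρ.IsInvInvariant] [SFinite ρ]
    (hρ : ρ = Measure.map (subgroupCongrHomeomorph (Quat.placesSplitting K D S).toMulEquiv _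
      (Subgroup.centralizer ({γ} : Set (adelicUnits K D)))
      (forall_apply_mem_centralizer_iff (Quat.placesSplitting K D S).toMulEquiv
        (γ₁ := fun v : S => toCompletionUnits K D (v : HeightOneSpectrum (𝓞 K)) γ) (γ₂ := ((Quat.placesSplitting K D S).symm γ).2)
        ((Quat.placesSplitting K D S).apply_symm_apply γ))
      (Quat.placesSplitting K D S).continuous (Quat.placesSplitting K D S).symm.continuous) ρq)
    -- Haar measures on the groups
    (νv : ∀ v : S, Measure (completionUnits D (v : HeightOneSpectrum (𝓞 K))))
    [∀ v, IsHaarMeasure (νv v)] [∀ v, (νv v).IsMulRightInvariant]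
    (ν' : Measure (Quat.trivialAt K D S)) [IsHaarMeasure ν'] [ν'.IsMulRightInvariant]
    (ν : Measure (adelicUnits K D)) [IsHaarMeasure ν] [ν.IsMulRightInvariant]
    (hν : ν = Measure.map (Quat.placesSplitting K D S) ((Measure.pi νv).prod ν'))

include hCv hC' hρp hρ₁ hρq hρ hν in
/-- **Gelbart's (10.19) on the `Dˣ` side with its equality sign, `[0, ∞]`-valued form.** With the
splitting `s = Quat.placesSplitting K D S : G_S × G^S ≃ₜ* D_𝔸ˣ`, `γ ∈ D_𝔸ˣ` with components
`γ_v` (`v ∈ S`), `γ^S = s_S(γ)`, closed tori `B_v = C(γ_v)`, `B^S = C(γ^S)`, Haar measures `ν_v`, `ν^S`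
on `G_v`, `G^S` and `ρ_v`, `ρ^S` on `B_v`, `B^S`, their products transported along `s` to `D_𝔸ˣ` and
to `B'_𝔸 = C(γ) = s((Π_v B'_v) × B'^S)` (hypotheses `hρp`, `hρ₁`, `hρq`, `hρ`, `hν`), and measurable
`Φ, ξ_v, Θ ≥ 0` with `Φ(ι_S(a) k) = (Π_v ξ_v(a_v)) Θ(k)`:
`∫⁻_{G_𝔸/B_𝔸} Φ(y γ y⁻¹) d(ν/ρ) = (Π_{v ∈ S} ∫⁻_{G_v/B_v} ξ_v(a γ_v a⁻¹) d(ν_v/ρ_v)) ∫⁻_{G^S/B^S} Θ(k γ^S k⁻¹) d(ν^S/ρ^S)`.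
[cite: Gelbart1975, p. 155 (10.19)] -/
theorem Quat.lintegral_descConj_quotientMeasure_eq_prod_mul
    {Φ : (adelicUnits K D) → ℝ≥0∞}
    {ξ : ∀ v : S, completionUnits D (v : HeightOneSpectrum (𝓞 K)) → ℝ≥0∞}
    {Θ : Quat.trivialAt K D S → ℝ≥0∞} (hΦ : Measurable Φ) (hξ : ∀ v, Measurable (ξ v)) (hΘ : Measurable Θ)
    (hΦe : ∀ (a : Quat.LocalPi K D S) (k : Quat.trivialAt K D S),
      Φ (Quat.toAdelicPi K D S a * (k : (adelicUnits K D))) = (∏ v : S, ξ v (a v)) * Θ k) :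
    ∫⁻ y, descConj γ (Subgroup.centralizer ({γ} : Set (adelicUnits K D)))
        (Literature.MeasureTheory.Group.centralizer_comm γ) Φ y
        ∂quotientMeasure (Subgroup.centralizer ({γ} : Set (adelicUnits K D))) ρ hC ν =
      (∏ v : S, ∫⁻ x, descConj (toCompletionUnits K D (v : HeightOneSpectrum (𝓞 K)) γ) _
          (Literature.MeasureTheory.Group.centralizer_comm _) (ξ v) x ∂quotientMeasure _ (ρv v) (hCv v) (νv v)) *
        ∫⁻ x, descConj ((Quat.placesSplitting K D S).symm γ).2 _
          (Literature.MeasureTheory.Group.centralizer_comm _) Θ x ∂quotientMeasure _ ρ' hC' ν' := by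
  haveI : ∀ v : HeightOneSpectrum (𝓞 K), T2Space (completionUnits D v) := fun v => inferInstance
  haveI : SecondCountableTopology (Quat.trivialAt K D S) := TopologicalSpace.Subtype.secondCountableTopology _
  have hγ : (Quat.placesSplitting K D S).toMulEquiv
      ((fun v : S => toCompletionUnits K D (v : HeightOneSpectrum (𝓞 K)) γ), ((Quat.placesSplitting K D S).symm γ).2) = γ :=
    (Quat.placesSplitting K D S).apply_symm_apply γ
  exact Literature.MeasureTheory.Group.lintegral_descConj_quotientMeasure_eq_prod_mul
    (Quat.placesSplitting K D S).toMulEquiv (Quat.placesSplitting K D S).continuous (Quat.placesSplitting K D S).symm.continuous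
    hγ hC hCv hC' ρv ρ' ρp hρp ρ₁ hρ₁ ρq hρq ρ hρ νv ν' ν hν hΦ hξ hΘ hΦe

include hCv hC' hρp hρ₁ hρq hρ hν in
/-- **Gelbart's (10.19) on the `Dˣ` side with its equality sign, complex-valued form** (same data; all
complex `Φ, ξ_v, Θ` with `Φ(ι_S(a) k) = (Π_v ξ_v(a_v)) Θ(k)`). [cite: Gelbart1975, p. 155 (10.19)] -/
theorem Quat.integral_descConj_quotientMeasure_eq_prod_mul
    (Φ : (adelicUnits K D) → ℂ) (ξ : ∀ v : S, completionUnits D (v : HeightOneSpectrum (𝓞 K)) → ℂ)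
    (Θ : Quat.trivialAt K D S → ℂ)
    (hΦe : ∀ (a : Quat.LocalPi K D S) (k : Quat.trivialAt K D S),
      Φ (Quat.toAdelicPi K D S a * (k : (adelicUnits K D))) = (∏ v : S, ξ v (a v)) * Θ k) :
    ∫ y, descConj γ (Subgroup.centralizer ({γ} : Set (adelicUnits K D)))
        (Literature.MeasureTheory.Group.centralizer_comm γ) Φ y
        ∂quotientMeasure (Subgroup.centralizer ({γ} : Set (adelicUnits K D))) ρ hC ν =
      (∏ v : S, ∫ x, descConj (toCompletionUnits K D (v : HeightOneSpectrum (𝓞 K)) γ) _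
          (Literature.MeasureTheory.Group.centralizer_comm _) (ξ v) x ∂quotientMeasure _ (ρv v) (hCv v) (νv v)) *
        ∫ x, descConj ((Quat.placesSplitting K D S).symm γ).2 _
          (Literature.MeasureTheory.Group.centralizer_comm _) Θ x ∂quotientMeasure _ ρ' hC' ν' := by
  haveI : ∀ v : HeightOneSpectrum (𝓞 K), T2Space (completionUnits D v) := fun v => inferInstance
  haveI : SecondCountableTopology (Quat.trivialAt K D S) := TopologicalSpace.Subtype.secondCountableTopology _
  have hγ : (Quat.placesSplitting K D S).toMulEquiv
      ((fun v : S => toCompletionUnits K D (v : HeightOneSpectrum (𝓞 K)) γ), ((Quat.placesSplitting K D S).symm γ).2) = γ :=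
    (Quat.placesSplitting K D S).apply_symm_apply γ
  exact Literature.MeasureTheory.Group.integral_descConj_quotientMeasure_eq_prod_mul
    (Quat.placesSplitting K D S).toMulEquiv (Quat.placesSplitting K D S).continuous (Quat.placesSplitting K D S).symm.continuous
    hγ hC hCv hC' ρv ρ' ρp hρp ρ₁ hρ₁ ρq hρq ρ hρ νv ν' ν hν Φ ξ Θ hΦe

end OrbitalNormalized

end Literature.NumberTheory.Automorphic
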